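import Summits.Ventures.GridStability.Models.ClassicalSwingGlobal
import Literature.Analysis.ODE.EvolutionMap
import HarnessLib

/-!
# GridStability/Lyapunov/ClassicalSwingForward — complements to the GLOBAL FLOW of the classical
# multimachine model: uniqueness on EVERY time interval (one-sided), «forward solution = global
# solution», `∃!`-packaging of the model-side sentences, Lipschitz dependence on the state

Venture GRIDFUSION, seat gridfusion-lyap-1 (g5), queue item (B) (lead g5 RULINGS BATCH 3 (6) / 4a (2)).
THE existence file is lyap-2's `Models/ClassicalSwingGlobal.lean` (p518035: for every
`p : ClassicalSwing n` — transfer conductances INCLUDED — `lipschitzWith_field`,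
`exists_isSolutionOn_univ`, `isSolutionOn_univ_unique`); NOTHING of it is restated here. This file
adds what the packaging of the «…Roa» / `lossy_slab_roa` / `lurie_roa` / `level_synchronisation`
sentences needs beyond `univ`:

* `IsSolutionOn.mono` / `.continuousOn` — a solution on a time set solves on every sub-set;
  `IsSolutionOn.comp_sub` / `exists_isSolutionOn_univ_at` — time shifts (autonomy): a global solution
  through every `(t₀, x₀)`;
* `IsSolutionOn.eqOn` — UNIQUENESS on any order-connected time set (`Ici t₀`, `Icc a b`, …) from
  agreement at one of its times (Grönwall with ONE-SIDED derivatives, tree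
  `Literature.Analysis.ODE.eqOn_uIcc_of_lipschitzWith`); `eqOn_Ici`, `eqOn_Icc`, `eq_of_eq_at`;
* `IsSolutionOn.exists_univ_extension(_Icc)` — every FORWARD solution on `[t₀, ∞)` (or `[a, b]`) is
  the restriction of the global one: the model-side sentences, all quantified over
  `IsSolutionOn c univ`, therefore lose nothing against solutions on `[0, ∞)`
  (`forall_Ici_iff_forall_univ`);
* `existsUnique_isSolutionOn_univ` — `∃!` form of p518035's pair; `existsUnique_and_forall` — the
  one-line upgrade «for every solution `c` on `univ` with `I (c 0)`: `Q c`» ⇒ «for every state `x₀`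
  with `I x₀`: exactly one global solution through `x₀`, and every one satisfies `Q`»;
* `exists_forall_dist_le` — Lipschitz dependence on the initial state, `e^{K|t − t₀|}` (Teschl (2.43)).

THREE COLUMNS. CERTIFIED (kernel): the statements above, about the MODEL CLASS `ClassicalSwing n`.
VALIDATED: nothing. MODELLED: as `Models/ClassicalSwing.lean` (MV-2). No sentence of this file says
a grid is stable.
-/

noncomputable section

open Real Set Filter Literature.Analysis.ODE
open scoped Topology NNReal

namespace Summit.Ventures.GridStability.Models.ClassicalSwing

variable {n : ℕ} {p : ClassicalSwing n}

/-! ### Restriction, continuity, time shifts -/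

/-- A solution on a time set is a solution on every smaller time set (derivatives within the
smaller set). In particular a global solution (`univ`) solves on `Ici 0`, on every `Icc 0 S`, … -/
theorem IsSolutionOn.mono {γ : ℝ → State n} {s s' : Set ℝ} (h : p.IsSolutionOn γ s)
    (hs : s' ⊆ s) : p.IsSolutionOn γ s' :=
  fun t ht => (h t (hs ht)).mono hs

/-- Solutions are continuous on their time set. -/
theorem IsSolutionOn.continuousOn {γ : ℝ → State n} {s : Set ℝ} (h : p.IsSolutionOn γ s) :
    ContinuousOn γ s :=
  fun t ht => (h t ht).continuousWithinAt

/-- Global solutions are continuous. -/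
theorem IsSolutionOn.continuous {γ : ℝ → State n} (h : p.IsSolutionOn γ univ) : Continuous γ :=
  continuousOn_univ.1 h.continuousOn

/-- **Autonomy (time shift)**: if `Γ` solves on `univ`, so does `t ↦ Γ (t − t₀)`. -/
theorem IsSolutionOn.comp_sub {Γ : ℝ → State n} (h : p.IsSolutionOn Γ univ) (t₀ : ℝ) :
    p.IsSolutionOn (fun t => Γ (t - t₀)) univ := fun t _ => by
  have h1 : HasDerivAt Γ (p.field (Γ (t - t₀))) (t - t₀) := (h (t - t₀) (mem_univ _)).hasDerivAt univ_mem
  have h2 : HasDerivAt (fun t : ℝ => t - t₀) 1 t := by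
    simpa using (hasDerivAt_id t).sub_const t₀
  have h3 : HasDerivAt (fun t => Γ (t - t₀)) (p.field (Γ (t - t₀))) t := by
    have := h1.scomp t h2
    simpa [Function.comp_def] using this
  exact h3.hasDerivWithinAt

variable (p) in
/-- **Global existence through every `(t₀, x₀)`** (p518035's `exists_isSolutionOn_univ` is `t₀ = 0`;
shift it). [cite: Teschl2012, Cor. 2.6 (PDF p. 52)] -/
theorem exists_isSolutionOn_univ_at (t₀ : ℝ) (x₀ : State n) :
    ∃ Γ : ℝ → State n, Γ t₀ = x₀ ∧ p.IsSolutionOn Γ univ := by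
  obtain ⟨Γ₀, h0, hΓ₀⟩ := p.exists_isSolutionOn_univ x₀
  exact ⟨fun t => Γ₀ (t - t₀), by simp [h0], hΓ₀.comp_sub t₀⟩

variable (p) in
/-- **Global existence, forward form**: from every state there is a solution on `[0, ∞)` and on
every `[0, S]` — the restriction of p518035's global one. [cite: Teschl2012, Cor. 2.6 (PDF p. 52)] -/
theorem exists_isSolutionOn_Ici (x₀ : State n) :
    ∃ γ : ℝ → State n, γ 0 = x₀ ∧ p.IsSolutionOn γ (Ici 0) ∧ ∀ S, p.IsSolutionOn γ (Icc 0 S) := by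
  obtain ⟨γ, h0, hγ⟩ := p.exists_isSolutionOn_univ x₀
  exact ⟨γ, h0, hγ.mono (subset_univ _), fun S => hγ.mono (subset_univ _)⟩

/-! ### Uniqueness on every interval -/

/-- **UNIQUENESS on any interval**: two solutions on an order-connected set of times (`univ`,
`Ici t₀`, `Icc a b`, …; derivatives one-sided at its ends) that agree at one of its times agree on
all of it (Grönwall, both time directions). [cite: Teschl2012, Thm. 2.2 (PDF p. 49)] -/
theorem IsSolutionOn.eqOn {γ₁ γ₂ : ℝ → State n} {S : Set ℝ} (h₁ : p.IsSolutionOn γ₁ S)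
    (h₂ : p.IsSolutionOn γ₂ S) (hS : S.OrdConnected) {t₀ : ℝ} (ht₀ : t₀ ∈ S)
    (h0 : γ₁ t₀ = γ₂ t₀) : EqOn γ₁ γ₂ S := by
  intro t ht
  have hsub : uIcc t₀ t ⊆ S := hS.uIcc_subset ht₀ ht
  exact eqOn_uIcc_of_lipschitzWith (v := fun _ : ℝ => p.field) (fun _ _ => p.lipschitzWith_field)
    (fun s hs => (h₁ s (hsub hs)).mono hsub) (fun s hs => (h₂ s (hsub hs)).mono hsub) h0
    right_mem_uIcc

/-- Uniqueness of FORWARD solutions on `[t₀, ∞)`. [cite: Teschl2012, Thm. 2.2 (PDF p. 49)] -/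
theorem IsSolutionOn.eqOn_Ici {γ₁ γ₂ : ℝ → State n} {t₀ : ℝ} (h₁ : p.IsSolutionOn γ₁ (Ici t₀))
    (h₂ : p.IsSolutionOn γ₂ (Ici t₀)) (h0 : γ₁ t₀ = γ₂ t₀) : EqOn γ₁ γ₂ (Ici t₀) :=
  h₁.eqOn h₂ ordConnected_Ici self_mem_Ici h0

/-- Uniqueness on a compact time interval `[a, b]`. [cite: Teschl2012, Thm. 2.2 (PDF p. 49)] -/
theorem IsSolutionOn.eqOn_Icc {γ₁ γ₂ : ℝ → State n} {a b : ℝ} (h₁ : p.IsSolutionOn γ₁ (Icc a b))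
    (h₂ : p.IsSolutionOn γ₂ (Icc a b)) (h0 : γ₁ a = γ₂ a) : EqOn γ₁ γ₂ (Icc a b) := by
  rcases le_or_gt a b with hab | hab
  · exact h₁.eqOn h₂ ordConnected_Icc (left_mem_Icc.2 hab) h0
  · rw [Icc_eq_empty_of_lt hab]
    exact eqOn_empty _ _

/-- Uniqueness of global solutions from agreement at ANY one time `t₀` (p518035's
`isSolutionOn_univ_unique` is the case `t₀ = 0`). [cite: Teschl2012, Thm. 2.2 (PDF p. 49)] -/
theorem IsSolutionOn.eq_of_eq_at {γ₁ γ₂ : ℝ → State n} (h₁ : p.IsSolutionOn γ₁ univ)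
    (h₂ : p.IsSolutionOn γ₂ univ) {t₀ : ℝ} (h0 : γ₁ t₀ = γ₂ t₀) : γ₁ = γ₂ :=
  funext fun t => h₁.eqOn h₂ ordConnected_univ (mem_univ t₀) h0 (mem_univ t)

variable (p) in
/-- **WELL-POSEDNESS (`∃!`)**: through every machine state there is EXACTLY ONE solution of the
classical model on all of `ℝ` (p518035's existence and uniqueness, packaged).
[cite: Teschl2012, Thm. 2.2 and Cor. 2.6 (PDF pp. 49, 52)] -/
theorem existsUnique_isSolutionOn_univ (x₀ : State n) :
    ∃! γ : ℝ → State n, γ 0 = x₀ ∧ p.IsSolutionOn γ univ := by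
  obtain ⟨γ, h0, hγ⟩ := p.exists_isSolutionOn_univ x₀
  exact ⟨γ, ⟨h0, hγ⟩, fun γ' h' => p.isSolutionOn_univ_unique h'.2 hγ (h'.1.trans h0.symm)⟩

variable (p) in
/-- `∃!` through every `(t₀, x₀)`. [cite: Teschl2012, Thm. 2.2 and Cor. 2.6 (PDF pp. 49, 52)] -/
theorem existsUnique_isSolutionOn_univ_at (t₀ : ℝ) (x₀ : State n) :
    ∃! γ : ℝ → State n, γ t₀ = x₀ ∧ p.IsSolutionOn γ univ := by
  obtain ⟨γ, h0, hγ⟩ := p.exists_isSolutionOn_univ_at t₀ x₀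
  exact ⟨γ, ⟨h0, hγ⟩, fun γ' h' => h'.2.eq_of_eq_at hγ (h'.1.trans h0.symm)⟩

/-! ### Forward solutions are the global ones -/

/-- **Every forward solution is the global one**: a solution on `[t₀, ∞)` extends (uniquely) to a
solution on all of `ℝ` agreeing with it on `[t₀, ∞)`. [cite: Teschl2012, Cor. 2.6 (PDF p. 52)] -/
theorem IsSolutionOn.exists_univ_extension {γ : ℝ → State n} {t₀ : ℝ}
    (h : p.IsSolutionOn γ (Ici t₀)) :
    ∃ Γ : ℝ → State n, Γ t₀ = γ t₀ ∧ p.IsSolutionOn Γ univ ∧ EqOn γ Γ (Ici t₀) := by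
  obtain ⟨Γ, h0, hΓ⟩ := p.exists_isSolutionOn_univ_at t₀ (γ t₀)
  exact ⟨Γ, h0, hΓ, h.eqOn_Ici (hΓ.mono (subset_univ _)) h0.symm⟩

/-- The same for solutions on a compact interval `[a, b]`. [cite: Teschl2012, Cor. 2.6 (PDF p. 52)] -/
theorem IsSolutionOn.exists_univ_extension_Icc {γ : ℝ → State n} {a b : ℝ}
    (h : p.IsSolutionOn γ (Icc a b)) :
    ∃ Γ : ℝ → State n, Γ a = γ a ∧ p.IsSolutionOn Γ univ ∧ EqOn γ Γ (Icc a b) := by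
  obtain ⟨Γ, h0, hΓ⟩ := p.exists_isSolutionOn_univ_at a (γ a)
  exact ⟨Γ, h0, hΓ, h.eqOn_Icc (hΓ.mono (subset_univ _)) h0.symm⟩

/-- **Forward properties transfer between the conventions**: a property `Q` of curves that only reads
times `≥ 0` (invariant under agreement on `[0, ∞)`) holds for every solution on `[0, ∞)` from `x₀`
iff it holds for every solution on `univ` from `x₀`. -/
theorem forall_Ici_iff_forall_univ {Q : (ℝ → State n) → Prop}
    (hQ : ∀ ⦃c c' : ℝ → State n⦄, EqOn c c' (Ici 0) → Q c' → Q c) (x₀ : State n) :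
    (∀ c, c 0 = x₀ → p.IsSolutionOn c (Ici 0) → Q c) ↔
      ∀ c, c 0 = x₀ → p.IsSolutionOn c univ → Q c := by
  refine ⟨fun H c h0 hc => H c h0 (hc.mono (subset_univ _)), fun H c h0 hc => ?_⟩
  obtain ⟨Γ, hΓ0, hΓ, heq⟩ := hc.exists_univ_extension
  exact hQ heq (H Γ (hΓ0.trans h0) hΓ)

/-- **Forward limits transfer**: if two curves agree on `[t₀, ∞)`, a limit at `+∞` of any observable
of one is the same limit for the other. -/
theorem tendsto_congr_of_eqOn_Ici {α : Type*} {γ₁ γ₂ : ℝ → State n} {t₀ : ℝ}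
    (h : EqOn γ₁ γ₂ (Ici t₀)) (g : State n → α) {l : Filter α}
    (h₂ : Tendsto (fun t => g (γ₂ t)) atTop l) : Tendsto (fun t => g (γ₁ t)) atTop l :=
  h₂.congr' (Filter.eventuallyEq_of_mem (Ici_mem_atTop t₀) fun t ht => by
    simp only [h ht])

/-! ### The one-line upgrade of an a-priori sentence -/

variable (p) in
/-- **`∃!` + a-priori ⇒ the sentence about THE motion**: if every solution `c` on `univ` whose initial
state satisfies `I` has property `Q`, then for every state `x₀` with `I x₀` there is EXACTLY ONE
global solution through `x₀`, and every global solution through `x₀` has `Q` — the upgrade of the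
model-side ROA sentences from «for every global solution (if any)» to «the motion from `x₀`». -/
theorem existsUnique_and_forall {I : State n → Prop} {Q : (ℝ → State n) → Prop}
    (H : ∀ ⦃c : ℝ → State n⦄, p.IsSolutionOn c univ → I (c 0) → Q c) {x₀ : State n} (hx : I x₀) :
    (∃! c : ℝ → State n, c 0 = x₀ ∧ p.IsSolutionOn c univ) ∧
      ∀ c : ℝ → State n, c 0 = x₀ → p.IsSolutionOn c univ → Q c :=
  ⟨p.existsUnique_isSolutionOn_univ x₀, fun _ h0 hc => H hc (h0 ▸ hx)⟩

/-! ### Continuous dependence on the initial state -/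

variable (p) in
/-- **Lipschitz dependence on the initial state** (Teschl (2.43)), with the constant of p518035: any
two solutions on an order-connected time set containing `t₀` satisfy
`dist (γ₁ t) (γ₂ t) ≤ dist (γ₁ t₀) (γ₂ t₀) · e^{K|t − t₀|}` on it, `K = lipConst`.
[cite: Teschl2012, eq. (2.43) (PDF p. 55)] -/
theorem IsSolutionOn.dist_le {γ₁ γ₂ : ℝ → State n} {S : Set ℝ} (h₁ : p.IsSolutionOn γ₁ S)
    (h₂ : p.IsSolutionOn γ₂ S) (hS : S.OrdConnected) {t₀ : ℝ} (ht₀ : t₀ ∈ S) {t : ℝ} (ht : t ∈ S) :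
    dist (γ₁ t) (γ₂ t) ≤ dist (γ₁ t₀) (γ₂ t₀) * Real.exp (Real.toNNReal p.lipConst * |t - t₀|) := by
  have hsub : uIcc t₀ t ⊆ S := hS.uIcc_subset ht₀ ht
  exact dist_le_of_lipschitzWith_uIcc (v := fun _ : ℝ => p.field) (fun _ _ => p.lipschitzWith_field)
    (fun s hs => (h₁ s (hsub hs)).mono hsub) (fun s hs => (h₂ s (hsub hs)).mono hsub)
    right_mem_uIcc

end Summit.Ventures.GridStability.Models.ClassicalSwing

end
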